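import Summits.Ventures.PercRepro.RankLevelSetLevelSevenCube
import Summits.Ventures.PercRepro.RankLevelSetCoreGeneralSharp

/-!
# PercRepro — THE LARGE-CORANK REGIME AT LEVEL `7` WITH EXACT ARITHMETIC, PART 1: THE INEQUALITY
`2^{p+79}·C(n, 7)/C(p+7, 7) + R₇(n) ≤ Σ_{7 ≤ k ≤ p−1} C(n, k)` FOR EVERY `p ≥ 73`, `n ≥ p + 91`
(p2, gen 34; a feeder for S4 — the top of the `q = 7` window)

night-1's THEOREM C∞ on the `e`-free core (`core_all_corank_of_thresholds_of_flat_bound`, RankLevelSetCoreGeneralSharp)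
closes the coranks `> 87` at level `7` from `p ≥ 103` (`c025_core_seven_beyond_sharp`); its floor `103` is the slack of the
regime-II arithmetic (`C(n − q, a) ≥ C(2a, a) ≥ 4^a/(2a + 1)`, `C(p − 1, q) ≤ C(p + q, q)`: ≈ `2^13` at `p = 103`), not of
its counts. With the SAME two counts — `#U ≤ #{r = 7} ≤ C(n, 7)·2^72` (the flat bound `f(7) ≤ 79`) and
`#Y ≥ Σ_{7 ≤ k ≤ p−1} C(n, k) − #{r ≤ 7}` (every `k`-set with `k ≤ p − 1` has rank `< p`; the rank-`≤ 7` sets through the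
flat bounds `79 / 39 / 19 / 10 / 6 / 3 / 1`, `R₇(n)`) — and `Φ(p, 7) ≤ 2^{p+7}/C(p+7, 7)`, the regime is the ONE inequality
above, proved here for every `p ≥ 73` and every `n ≥ p + 91` (`largeSeven_all`) by a numerical base at
`(p, n) = (73, 164)`, a doubling step in `p` along `n = p + 91` (the left side at most doubles since
`(n + 1)(p + 1) ≤ (n − 6)(p + 8)` and `R₇(n + 1) ≤ 2·R₇(n)`; the right side at least doubles by Pascal) and a
monotonicity step in `n` (every term of the left side grows by at most the factor `(n + 1)/(n − 6)` of `C(n, 7)`, every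
term of the right side by at least it). Part 2 (RankLevelSetCoreSevenLargeCorank) applies it to the core. Axioms: standard.
-/

set_option exponentiation.threshold 1024

namespace PercRepro

namespace ThmN

open Set

variable {α : Type}

/-- `C(n+1, k)·(n − 6) ≤ C(n, k)·(n + 1)` for `k ≤ 7` (`C(n, k)(n + 1) = C(n+1, k)(n + 1 − k)`). -/
theorem choose_succ_mul_sub_six_le (n k : ℕ) (hk : k ≤ 7) :
    (n + 1).choose k * (n - 6) ≤ n.choose k * (n + 1) := by
  have h := Nat.choose_mul_succ_eq n k
  calc (n + 1).choose k * (n - 6) ≤ (n + 1).choose k * (n + 1 - k) := Nat.mul_le_mul_left _ (by omega)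
    _ = n.choose k * (n + 1) := h.symm

/-- `C(n, k)·(n + 1) ≤ C(n+1, k)·(n − 6)` for `7 ≤ k`. -/
theorem choose_mul_succ_le_choose_succ_mul_sub_six (n k : ℕ) (hk : 7 ≤ k) :
    n.choose k * (n + 1) ≤ (n + 1).choose k * (n - 6) := by
  have h := Nat.choose_mul_succ_eq n k
  calc n.choose k * (n + 1) = (n + 1).choose k * (n + 1 - k) := h
    _ ≤ (n + 1).choose k * (n - 6) := Nat.mul_le_mul_left _ (by omega)

/-- `C(n+1, 7)·(n − 6) = C(n, 7)·(n + 1)` for `n ≥ 6`. -/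
theorem choose_succ_seven_mul_sub_six (n : ℕ) (hn : 6 ≤ n) :
    (n + 1).choose 7 * (n - 6) = n.choose 7 * (n + 1) := by
  have h := Nat.choose_mul_succ_eq n 7
  rw [show n + 1 - 7 = n - 6 by omega] at h
  exact h.symm

/-- **The flat tail `R₇` grows by at most the factor `(n + 1)/(n − 6)`**: `R₇(n+1)·(n − 6) ≤ R₇(n)·(n + 1)`. -/
theorem flatTail_seven_succ_mul_sub_six_le (n : ℕ) :
    ((n + 1).choose 7 * 2 ^ 72 + (n + 1).choose 6 * 2 ^ 33 + (n + 1).choose 5 * 2 ^ 14 + (n + 1).choose 4 * 2 ^ 6 +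
      (n + 1).choose 3 * 2 ^ 3 + (n + 1).choose 2 * 2 + (n + 1) + 1) * (n - 6) ≤
    (n.choose 7 * 2 ^ 72 + n.choose 6 * 2 ^ 33 + n.choose 5 * 2 ^ 14 + n.choose 4 * 2 ^ 6 +
      n.choose 3 * 2 ^ 3 + n.choose 2 * 2 + n + 1) * (n + 1) := by
  have h7 := choose_succ_mul_sub_six_le n 7 (by norm_num)
  have h6 := choose_succ_mul_sub_six_le n 6 (by norm_num)
  have h5 := choose_succ_mul_sub_six_le n 5 (by norm_num)
  have h4 := choose_succ_mul_sub_six_le n 4 (by norm_num)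
  have h3 := choose_succ_mul_sub_six_le n 3 (by norm_num)
  have h2 := choose_succ_mul_sub_six_le n 2 (by norm_num)
  have h1 : (n + 1) * (n - 6) ≤ n * (n + 1) := by
    calc (n + 1) * (n - 6) = (n - 6) * (n + 1) := by ring
      _ ≤ n * (n + 1) := Nat.mul_le_mul_right _ (by omega)
  have h0 : 1 * (n - 6) ≤ 1 * (n + 1) := by omega
  calc ((n + 1).choose 7 * 2 ^ 72 + (n + 1).choose 6 * 2 ^ 33 + (n + 1).choose 5 * 2 ^ 14 + (n + 1).choose 4 * 2 ^ 6 +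
        (n + 1).choose 3 * 2 ^ 3 + (n + 1).choose 2 * 2 + (n + 1) + 1) * (n - 6)
      = ((n + 1).choose 7 * (n - 6)) * 2 ^ 72 + ((n + 1).choose 6 * (n - 6)) * 2 ^ 33 +
        ((n + 1).choose 5 * (n - 6)) * 2 ^ 14 + ((n + 1).choose 4 * (n - 6)) * 2 ^ 6 +
        ((n + 1).choose 3 * (n - 6)) * 2 ^ 3 + ((n + 1).choose 2 * (n - 6)) * 2 + (n + 1) * (n - 6) +
        1 * (n - 6) := by ring
    _ ≤ (n.choose 7 * (n + 1)) * 2 ^ 72 + (n.choose 6 * (n + 1)) * 2 ^ 33 +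
        (n.choose 5 * (n + 1)) * 2 ^ 14 + (n.choose 4 * (n + 1)) * 2 ^ 6 +
        (n.choose 3 * (n + 1)) * 2 ^ 3 + (n.choose 2 * (n + 1)) * 2 + n * (n + 1) + 1 * (n + 1) := by
        gcongr
    _ = (n.choose 7 * 2 ^ 72 + n.choose 6 * 2 ^ 33 + n.choose 5 * 2 ^ 14 + n.choose 4 * 2 ^ 6 +
        n.choose 3 * 2 ^ 3 + n.choose 2 * 2 + n + 1) * (n + 1) := by ring

/-- **The flat tail at most doubles**: `R₇(n+1) ≤ 2·R₇(n)` for `n ≥ 14`. -/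
theorem flatTail_seven_succ_le_two_mul (n : ℕ) (hn : 14 ≤ n) :
    (n + 1).choose 7 * 2 ^ 72 + (n + 1).choose 6 * 2 ^ 33 + (n + 1).choose 5 * 2 ^ 14 + (n + 1).choose 4 * 2 ^ 6 +
      (n + 1).choose 3 * 2 ^ 3 + (n + 1).choose 2 * 2 + (n + 1) + 1 ≤
    2 * (n.choose 7 * 2 ^ 72 + n.choose 6 * 2 ^ 33 + n.choose 5 * 2 ^ 14 + n.choose 4 * 2 ^ 6 +
      n.choose 3 * 2 ^ 3 + n.choose 2 * 2 + n + 1) := by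
  have h7 := choose_succ_le_two_mul_of_two_mul_le_cube n 7 (by omega)
  have h6 := choose_succ_le_two_mul_of_two_mul_le_cube n 6 (by omega)
  have h5 := choose_succ_le_two_mul_of_two_mul_le_cube n 5 (by omega)
  have h4 := choose_succ_le_two_mul_of_two_mul_le_cube n 4 (by omega)
  have h3 := choose_succ_le_two_mul_of_two_mul_le_cube n 3 (by omega)
  have h2 := choose_succ_le_two_mul_of_two_mul_le_cube n 2 (by omega)
  nlinarith [h7, h6, h5, h4, h3, h2]

/-- The mid sum grows by at least the factor `(n + 1)/(n − 6)`: `Σ_{k ∈ Ico 7 p} C(n, k)·(n + 1) ≤ Σ_{k ∈ Ico 7 p} C(n+1, k)·(n − 6)`. -/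
theorem sum_Ico_choose_mul_succ_le_sum_succ_mul_sub_six (n p : ℕ) :
    (∑ k ∈ Finset.Ico 7 p, n.choose k) * (n + 1) ≤ (∑ k ∈ Finset.Ico 7 p, (n + 1).choose k) * (n - 6) := by
  rw [Finset.sum_mul, Finset.sum_mul]
  apply Finset.sum_le_sum
  intro k hk
  rw [Finset.mem_Ico] at hk
  exact choose_mul_succ_le_choose_succ_mul_sub_six n k hk.1

/-- **Pascal on the mid sum**: `Σ_{k ∈ Ico 7 (p+1)} C(n+1, k) = 2·Σ_{k ∈ Ico 7 p} C(n, k) + C(n, p) + C(n, 6)` for `7 ≤ p`. -/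
theorem sum_Ico_choose_succ_eq_two_mul_add (n p : ℕ) (hp : 7 ≤ p) :
    ∑ k ∈ Finset.Ico 7 (p + 1), (n + 1).choose k =
      2 * ∑ k ∈ Finset.Ico 7 p, n.choose k + n.choose p + n.choose 6 := by
  induction p, hp using Nat.le_induction with
  | base =>
    rw [Finset.sum_Ico_succ_top (le_refl 7), Finset.Ico_self, Finset.sum_empty, Finset.sum_empty,
      show (7 : ℕ) = 6 + 1 from rfl, Nat.choose_succ_succ]
    ring
  | succ p hp ih =>
    rw [Finset.sum_Ico_succ_top (by omega : 7 ≤ p + 1), ih, Finset.sum_Ico_succ_top (by omega : 7 ≤ p),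
      Nat.choose_succ_succ]
    ring

/-- The mid sum at least doubles: `2·Σ_{k ∈ Ico 7 p} C(n, k) ≤ Σ_{k ∈ Ico 7 (p+1)} C(n+1, k)` for `7 ≤ p`. -/
theorem two_mul_sum_Ico_choose_le_sum_succ (n p : ℕ) (hp : 7 ≤ p) :
    2 * ∑ k ∈ Finset.Ico 7 p, n.choose k ≤ ∑ k ∈ Finset.Ico 7 (p + 1), (n + 1).choose k := by
  rw [sum_Ico_choose_succ_eq_two_mul_add n p hp]
  omega

/-- `C(n+1, 7)·C(p+7, 7) ≤ C(n, 7)·C(p+8, 7)` once `p + 7 ≤ n` (the ratio `(n+1)(p+1)/((n−6)(p+8)) ≤ 1`). -/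
theorem choose_succ_seven_mul_le (n p : ℕ) (hn : p + 7 ≤ n) :
    (n + 1).choose 7 * (p + 7).choose 7 ≤ n.choose 7 * (p + 8).choose 7 := by
  have e1 := choose_succ_seven_mul_sub_six n (by omega)
  have e2 : (p + 8).choose 7 * (p + 1) = (p + 7).choose 7 * (p + 8) := by
    have h := Nat.choose_mul_succ_eq (p + 7) 7
    rw [show p + 7 + 1 - 7 = p + 1 by omega, show p + 7 + 1 = p + 8 by omega] at h
    exact h.symm
  have hpos : 0 < (n - 6) * (p + 1) := by
    have : 0 < n - 6 := by omega
    positivity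
  apply Nat.le_of_mul_le_mul_right _ hpos
  calc (n + 1).choose 7 * (p + 7).choose 7 * ((n - 6) * (p + 1))
      = ((n + 1).choose 7 * (n - 6)) * (p + 7).choose 7 * (p + 1) := by ring
    _ = (n.choose 7 * (n + 1)) * (p + 7).choose 7 * (p + 1) := by rw [e1]
    _ = n.choose 7 * (p + 7).choose 7 * ((n + 1) * (p + 1)) := by ring
    _ ≤ n.choose 7 * (p + 7).choose 7 * ((n - 6) * (p + 8)) := by
        apply Nat.mul_le_mul_left
        have h1 : (n + 1) * (p + 1) = n * p + n + p + 1 := by ring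
        have h2 : (n - 6) * (p + 8) = n * p + 8 * n - 6 * p - 48 := by
          have hn6 : 6 ≤ n := by omega
          obtain ⟨m, rfl⟩ : ∃ m, n = m + 6 := ⟨n - 6, by omega⟩
          rw [show m + 6 - 6 = m by omega]
          have : (m + 6) * p + 8 * (m + 6) - 6 * p - 48 = m * p + 8 * m := by
            have : (m + 6) * p + 8 * (m + 6) = m * p + 8 * m + 6 * p + 48 := by ring
            omega
          rw [this]; ring
        have h3 : n * p + n + p + 1 ≤ n * p + 8 * n - 6 * p - 48 := by
          have : 7 * p + 49 ≤ 7 * n := by omega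
          have h4 : n * p + 8 * n ≥ 6 * p + 48 := by nlinarith
          omega
        omega
    _ = n.choose 7 * ((p + 7).choose 7 * (p + 8)) * (n - 6) := by ring
    _ = n.choose 7 * ((p + 8).choose 7 * (p + 1)) * (n - 6) := by rw [e2]
    _ = n.choose 7 * (p + 8).choose 7 * ((n - 6) * (p + 1)) := by ring

/-- **The base `(p, n) = (73, 164)`** of the large-corank inequality (the numerical margin is `1.61`). -/
theorem largeSeven_base :
    (2 : ℚ) ^ (73 + 79) * ((73 + 91).choose 7 : ℚ) / ((73 + 7).choose 7 : ℚ) +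
    (((73 + 91).choose 7 * 2 ^ 72 + (73 + 91).choose 6 * 2 ^ 33 + (73 + 91).choose 5 * 2 ^ 14 + (73 + 91).choose 4 * 2 ^ 6 +
      (73 + 91).choose 3 * 2 ^ 3 + (73 + 91).choose 2 * 2 + (73 + 91) + 1 : ℕ) : ℚ) ≤
    ((∑ k ∈ Finset.Ico 7 73, (73 + 91).choose k : ℕ) : ℚ) := by
  rw [Finset.sum_Ico_eq_sum_range]
  simp only [Finset.sum_range_succ, Finset.sum_range_zero, Nat.choose_eq_descFactorial_div_factorial]
  norm_num

/-- **The step in `n`**: the inequality at `(p, n)` gives it at `(p, n + 1)` for `n ≥ 7`. -/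
theorem largeSeven_step_n (p n : ℕ) (hn : 7 ≤ n)
    (h : (2 : ℚ) ^ (p + 79) * (n.choose 7 : ℚ) / ((p + 7).choose 7 : ℚ) +
      ((n.choose 7 * 2 ^ 72 + n.choose 6 * 2 ^ 33 + n.choose 5 * 2 ^ 14 + n.choose 4 * 2 ^ 6 +
        n.choose 3 * 2 ^ 3 + n.choose 2 * 2 + n + 1 : ℕ) : ℚ) ≤
      ((∑ k ∈ Finset.Ico 7 p, n.choose k : ℕ) : ℚ)) :
    (2 : ℚ) ^ (p + 79) * ((n + 1).choose 7 : ℚ) / ((p + 7).choose 7 : ℚ) +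
    (((n + 1).choose 7 * 2 ^ 72 + (n + 1).choose 6 * 2 ^ 33 + (n + 1).choose 5 * 2 ^ 14 + (n + 1).choose 4 * 2 ^ 6 +
      (n + 1).choose 3 * 2 ^ 3 + (n + 1).choose 2 * 2 + (n + 1) + 1 : ℕ) : ℚ) ≤
    ((∑ k ∈ Finset.Ico 7 p, (n + 1).choose k : ℕ) : ℚ) := by
  have hc : (0 : ℚ) < ((p + 7).choose 7 : ℚ) := by exact_mod_cast Nat.choose_pos (by omega)
  have hm : (0 : ℚ) < ((n - 6 : ℕ) : ℚ) := by exact_mod_cast (show 0 < n - 6 by omega)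
  have e7 : (((n + 1).choose 7 : ℕ) : ℚ) * ((n - 6 : ℕ) : ℚ) = (n.choose 7 : ℚ) * ((n + 1 : ℕ) : ℚ) := by
    exact_mod_cast choose_succ_seven_mul_sub_six n (by omega)
  have hR : (((n + 1).choose 7 * 2 ^ 72 + (n + 1).choose 6 * 2 ^ 33 + (n + 1).choose 5 * 2 ^ 14 +
      (n + 1).choose 4 * 2 ^ 6 + (n + 1).choose 3 * 2 ^ 3 + (n + 1).choose 2 * 2 + (n + 1) + 1 : ℕ) : ℚ) *
      ((n - 6 : ℕ) : ℚ) ≤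
      ((n.choose 7 * 2 ^ 72 + n.choose 6 * 2 ^ 33 + n.choose 5 * 2 ^ 14 + n.choose 4 * 2 ^ 6 +
        n.choose 3 * 2 ^ 3 + n.choose 2 * 2 + n + 1 : ℕ) : ℚ) * ((n + 1 : ℕ) : ℚ) := by
    exact_mod_cast flatTail_seven_succ_mul_sub_six_le n
  have hS : ((∑ k ∈ Finset.Ico 7 p, n.choose k : ℕ) : ℚ) * ((n + 1 : ℕ) : ℚ) ≤
      ((∑ k ∈ Finset.Ico 7 p, (n + 1).choose k : ℕ) : ℚ) * ((n - 6 : ℕ) : ℚ) := by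
    exact_mod_cast sum_Ico_choose_mul_succ_le_sum_succ_mul_sub_six n p
  -- multiply the target by `n − 6 > 0`
  apply le_of_mul_le_mul_right _ hm
  have hT : (2 : ℚ) ^ (p + 79) * (((n + 1).choose 7 : ℕ) : ℚ) / ((p + 7).choose 7 : ℚ) * ((n - 6 : ℕ) : ℚ) =
      (2 : ℚ) ^ (p + 79) * (n.choose 7 : ℚ) / ((p + 7).choose 7 : ℚ) * ((n + 1 : ℕ) : ℚ) := by
    rw [mul_div_assoc, mul_div_assoc, mul_assoc, mul_assoc, div_mul_eq_mul_div, div_mul_eq_mul_div, e7]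
  calc ((2 : ℚ) ^ (p + 79) * (((n + 1).choose 7 : ℕ) : ℚ) / ((p + 7).choose 7 : ℚ) +
        (((n + 1).choose 7 * 2 ^ 72 + (n + 1).choose 6 * 2 ^ 33 + (n + 1).choose 5 * 2 ^ 14 +
          (n + 1).choose 4 * 2 ^ 6 + (n + 1).choose 3 * 2 ^ 3 + (n + 1).choose 2 * 2 + (n + 1) + 1 : ℕ) : ℚ)) *
        ((n - 6 : ℕ) : ℚ)
      = (2 : ℚ) ^ (p + 79) * (((n + 1).choose 7 : ℕ) : ℚ) / ((p + 7).choose 7 : ℚ) * ((n - 6 : ℕ) : ℚ) +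
        (((n + 1).choose 7 * 2 ^ 72 + (n + 1).choose 6 * 2 ^ 33 + (n + 1).choose 5 * 2 ^ 14 +
          (n + 1).choose 4 * 2 ^ 6 + (n + 1).choose 3 * 2 ^ 3 + (n + 1).choose 2 * 2 + (n + 1) + 1 : ℕ) : ℚ) *
        ((n - 6 : ℕ) : ℚ) := by ring
    _ ≤ (2 : ℚ) ^ (p + 79) * (n.choose 7 : ℚ) / ((p + 7).choose 7 : ℚ) * ((n + 1 : ℕ) : ℚ) +
        ((n.choose 7 * 2 ^ 72 + n.choose 6 * 2 ^ 33 + n.choose 5 * 2 ^ 14 + n.choose 4 * 2 ^ 6 +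
          n.choose 3 * 2 ^ 3 + n.choose 2 * 2 + n + 1 : ℕ) : ℚ) * ((n + 1 : ℕ) : ℚ) := by
        rw [hT]; exact add_le_add le_rfl hR
    _ = ((2 : ℚ) ^ (p + 79) * (n.choose 7 : ℚ) / ((p + 7).choose 7 : ℚ) +
        ((n.choose 7 * 2 ^ 72 + n.choose 6 * 2 ^ 33 + n.choose 5 * 2 ^ 14 + n.choose 4 * 2 ^ 6 +
          n.choose 3 * 2 ^ 3 + n.choose 2 * 2 + n + 1 : ℕ) : ℚ)) * ((n + 1 : ℕ) : ℚ) := by ring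
    _ ≤ ((∑ k ∈ Finset.Ico 7 p, n.choose k : ℕ) : ℚ) * ((n + 1 : ℕ) : ℚ) := by
        apply mul_le_mul_of_nonneg_right h (by positivity)
    _ ≤ ((∑ k ∈ Finset.Ico 7 p, (n + 1).choose k : ℕ) : ℚ) * ((n - 6 : ℕ) : ℚ) := hS

/-- **The step in `p` along `n = p + D`**: the inequality at `(p, n)` gives it at `(p + 1, n + 1)` for `7 ≤ p`, `p + 7 ≤ n`,
`14 ≤ n`. -/
theorem largeSeven_step_p (p n : ℕ) (hp : 7 ≤ p) (hn : p + 7 ≤ n) (hn14 : 14 ≤ n)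
    (h : (2 : ℚ) ^ (p + 79) * (n.choose 7 : ℚ) / ((p + 7).choose 7 : ℚ) +
      ((n.choose 7 * 2 ^ 72 + n.choose 6 * 2 ^ 33 + n.choose 5 * 2 ^ 14 + n.choose 4 * 2 ^ 6 +
        n.choose 3 * 2 ^ 3 + n.choose 2 * 2 + n + 1 : ℕ) : ℚ) ≤
      ((∑ k ∈ Finset.Ico 7 p, n.choose k : ℕ) : ℚ)) :
    (2 : ℚ) ^ ((p + 1) + 79) * ((n + 1).choose 7 : ℚ) / (((p + 1) + 7).choose 7 : ℚ) +
    (((n + 1).choose 7 * 2 ^ 72 + (n + 1).choose 6 * 2 ^ 33 + (n + 1).choose 5 * 2 ^ 14 + (n + 1).choose 4 * 2 ^ 6 +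
      (n + 1).choose 3 * 2 ^ 3 + (n + 1).choose 2 * 2 + (n + 1) + 1 : ℕ) : ℚ) ≤
    ((∑ k ∈ Finset.Ico 7 (p + 1), (n + 1).choose k : ℕ) : ℚ) := by
  have hc : (0 : ℚ) < ((p + 7).choose 7 : ℚ) := by exact_mod_cast Nat.choose_pos (by omega)
  have hc' : (0 : ℚ) < ((p + 1 + 7).choose 7 : ℚ) := by exact_mod_cast Nat.choose_pos (by omega)
  -- (a) the first term at most doubles
  have ha : (2 : ℚ) ^ (p + 1 + 79) * (((n + 1).choose 7 : ℕ) : ℚ) / ((p + 1 + 7).choose 7 : ℚ) ≤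
      2 * ((2 : ℚ) ^ (p + 79) * (n.choose 7 : ℚ) / ((p + 7).choose 7 : ℚ)) := by
    have hk : (((n + 1).choose 7 : ℕ) : ℚ) * ((p + 7).choose 7 : ℚ) ≤ (n.choose 7 : ℚ) * ((p + 8).choose 7 : ℚ) := by
      exact_mod_cast choose_succ_seven_mul_le n p hn
    have hc8 : (0 : ℚ) < ((p + 8).choose 7 : ℚ) := by exact_mod_cast Nat.choose_pos (by omega)
    have e1 : (2 : ℚ) ^ (p + 1 + 79) * (((n + 1).choose 7 : ℕ) : ℚ) / ((p + 1 + 7).choose 7 : ℚ) =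
        ((2 : ℚ) ^ (p + 80) / (((p + 7).choose 7 : ℚ) * ((p + 8).choose 7 : ℚ))) *
          ((((n + 1).choose 7 : ℕ) : ℚ) * ((p + 7).choose 7 : ℚ)) := by
      rw [show p + 1 + 7 = p + 8 by ring, show p + 1 + 79 = p + 80 by ring]
      field_simp
    have e2 : 2 * ((2 : ℚ) ^ (p + 79) * (n.choose 7 : ℚ) / ((p + 7).choose 7 : ℚ)) =
        ((2 : ℚ) ^ (p + 80) / (((p + 7).choose 7 : ℚ) * ((p + 8).choose 7 : ℚ))) *
          ((n.choose 7 : ℚ) * ((p + 8).choose 7 : ℚ)) := by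
      rw [show p + 80 = p + 79 + 1 by ring, pow_succ]
      field_simp
      ring
    rw [e1, e2]
    exact mul_le_mul_of_nonneg_left hk (by positivity)
  -- (b) the flat tail at most doubles
  have hb : (((n + 1).choose 7 * 2 ^ 72 + (n + 1).choose 6 * 2 ^ 33 + (n + 1).choose 5 * 2 ^ 14 +
      (n + 1).choose 4 * 2 ^ 6 + (n + 1).choose 3 * 2 ^ 3 + (n + 1).choose 2 * 2 + (n + 1) + 1 : ℕ) : ℚ) ≤
      2 * ((n.choose 7 * 2 ^ 72 + n.choose 6 * 2 ^ 33 + n.choose 5 * 2 ^ 14 + n.choose 4 * 2 ^ 6 +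
        n.choose 3 * 2 ^ 3 + n.choose 2 * 2 + n + 1 : ℕ) : ℚ) := by
    exact_mod_cast flatTail_seven_succ_le_two_mul n hn14
  -- (c) the mid sum at least doubles
  have hcc : 2 * ((∑ k ∈ Finset.Ico 7 p, n.choose k : ℕ) : ℚ) ≤
      ((∑ k ∈ Finset.Ico 7 (p + 1), (n + 1).choose k : ℕ) : ℚ) := by
    exact_mod_cast two_mul_sum_Ico_choose_le_sum_succ n p hp
  calc (2 : ℚ) ^ (p + 1 + 79) * (((n + 1).choose 7 : ℕ) : ℚ) / ((p + 1 + 7).choose 7 : ℚ) +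
        (((n + 1).choose 7 * 2 ^ 72 + (n + 1).choose 6 * 2 ^ 33 + (n + 1).choose 5 * 2 ^ 14 +
          (n + 1).choose 4 * 2 ^ 6 + (n + 1).choose 3 * 2 ^ 3 + (n + 1).choose 2 * 2 + (n + 1) + 1 : ℕ) : ℚ)
      ≤ 2 * ((2 : ℚ) ^ (p + 79) * (n.choose 7 : ℚ) / ((p + 7).choose 7 : ℚ)) +
        2 * ((n.choose 7 * 2 ^ 72 + n.choose 6 * 2 ^ 33 + n.choose 5 * 2 ^ 14 + n.choose 4 * 2 ^ 6 +
          n.choose 3 * 2 ^ 3 + n.choose 2 * 2 + n + 1 : ℕ) : ℚ) := add_le_add ha hb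
    _ = 2 * ((2 : ℚ) ^ (p + 79) * (n.choose 7 : ℚ) / ((p + 7).choose 7 : ℚ) +
        ((n.choose 7 * 2 ^ 72 + n.choose 6 * 2 ^ 33 + n.choose 5 * 2 ^ 14 + n.choose 4 * 2 ^ 6 +
          n.choose 3 * 2 ^ 3 + n.choose 2 * 2 + n + 1 : ℕ) : ℚ)) := by ring
    _ ≤ 2 * ((∑ k ∈ Finset.Ico 7 p, n.choose k : ℕ) : ℚ) := mul_le_mul_of_nonneg_left h (by norm_num)
    _ ≤ ((∑ k ∈ Finset.Ico 7 (p + 1), (n + 1).choose k : ℕ) : ℚ) := hcc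

/-- **The large-corank inequality for every `p ≥ 73` and every `n ≥ p + 91`** (the base `(73, 164)`, the steps). -/
theorem largeSeven_all (p : ℕ) (hp : 73 ≤ p) (n : ℕ) (hn : p + 91 ≤ n) :
    (2 : ℚ) ^ (p + 79) * (n.choose 7 : ℚ) / ((p + 7).choose 7 : ℚ) +
    ((n.choose 7 * 2 ^ 72 + n.choose 6 * 2 ^ 33 + n.choose 5 * 2 ^ 14 + n.choose 4 * 2 ^ 6 +
      n.choose 3 * 2 ^ 3 + n.choose 2 * 2 + n + 1 : ℕ) : ℚ) ≤
    ((∑ k ∈ Finset.Ico 7 p, n.choose k : ℕ) : ℚ) := by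
  have hdiag : ∀ p, 73 ≤ p → (2 : ℚ) ^ (p + 79) * ((p + 91).choose 7 : ℚ) / ((p + 7).choose 7 : ℚ) +
      (((p + 91).choose 7 * 2 ^ 72 + (p + 91).choose 6 * 2 ^ 33 + (p + 91).choose 5 * 2 ^ 14 + (p + 91).choose 4 * 2 ^ 6 +
        (p + 91).choose 3 * 2 ^ 3 + (p + 91).choose 2 * 2 + (p + 91) + 1 : ℕ) : ℚ) ≤
      ((∑ k ∈ Finset.Ico 7 p, (p + 91).choose k : ℕ) : ℚ) := by
    intro p hp
    induction p, hp using Nat.le_induction with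
    | base => exact largeSeven_base
    | succ p hp ih =>
      rw [show p + 1 + 91 = p + 91 + 1 by ring]
      exact largeSeven_step_p p (p + 91) (by omega) (by omega) (by omega) ih
  have hall : ∀ n, p + 91 ≤ n → (2 : ℚ) ^ (p + 79) * (n.choose 7 : ℚ) / ((p + 7).choose 7 : ℚ) +
      ((n.choose 7 * 2 ^ 72 + n.choose 6 * 2 ^ 33 + n.choose 5 * 2 ^ 14 + n.choose 4 * 2 ^ 6 +
        n.choose 3 * 2 ^ 3 + n.choose 2 * 2 + n + 1 : ℕ) : ℚ) ≤
      ((∑ k ∈ Finset.Ico 7 p, n.choose k : ℕ) : ℚ) := by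
    intro n hn
    induction n, hn using Nat.le_induction with
    | base => exact hdiag p hp
    | succ n hn ih => exact largeSeven_step_n p n (by omega) ih
  exact hall n hn

end ThmN

end PercRepro
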